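import Summits.Ventures.Crystal3D.Kissing125.SearchDefs1
import Summits.Ventures.Crystal3D.Kissing125.Estimates4
import Literature.Geometry.DiscreteGeometry.SphericalCodeHullVertexLink
import Literature.Geometry.DiscreteGeometry.SphericalCodeHullConnected
import Literature.Geometry.DiscreteGeometry.KissingUnitContactDegree
import Literature.Geometry.DiscreteGeometry.KissingNodeDegree
import Literature.Geometry.DiscreteGeometry.KissingRigidity
import HarnessLib

/-!
# The class `𝒱(5/2)`, its `KConf` at `κ = 7/32`, and rigidity at `σ = 7/8` — K25 copy at `κ = 7/32` (`h = 5/4`), part 1/4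

HONEST FRAMING (cell pub-crystal3d, K-path at `h = 5/4`): this is NOT a result printed by Hales.  It is his
METHOD (arXiv:1209.6043, Theorem 3: the main estimate + the classification of the contact graphs of kissing
configurations, in the tree's form of a verified interval-arithmetic growth search, `Literature/…/KissingSearch*.lean`)
RE-RUN at the separation `5/2` instead of `2h₀ = 2.52` (largest long-side cosine `κ = 1 − (5/4)²/2 = 7/32` instead of
`κ₀ = 1031/5000`).  The declarations are namespace-shadowing COPIES of the tree's declarations (same names, inside
`namespace Summit.Ventures.Crystal3D.Kissing125[.KissingSearch]`, original docstrings and citation tags kept — the tags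
name the printed METHOD step each declaration implements); the diff to the originals is stated per file.  Generated by
`HOME/lean/kissing125/gen/mkfiles.py`; audit recipe in `HOME/lean/kissing125/README.md`.  Nothing here is asserted
about GAP(1.26) or any census.

THIS FILE: (a) the predicate `IsKissingConfig25` (= `IsGapKissingConfig (5/2)` of `Bulk/GapReduction.lean`, same shape) with its `V/2` bookkeeping (copies of `FejesTothKissingTwelve` / `KissingFacetPenalty` Part C lemmas, separation `⟪·,·⟫ = 1/2 ∨ ≤ 7/32`); (b) `≤ 4` contacts at a point: copy of `KissingNodeDegree` Part D with `2h₀ ↦ 5/2` (numeric input `1 − (5/2)²/6 = −1/24 < 17/81`) and of `KissingUnitContactDegree`; (c) the geometric dictionary: copy of `KissingSearchGeometry.lean` (`IsKissingConfig ↦ IsKissingConfig25`, the structure `KConf` being the 7/32 one of `SearchDefs`), ending in `contactGraphFccOrHcp25_of_forall_concl`; (d) Lemma 10 at `σ = 4 − 2(5/4)² = 7/8 < 8/9`: copy of `isArrangedIn_of_contactGraph_iso` (+ FCC/HCP corollaries) on the tree's generic `IsRealization` rigidity, and `isArrangedIn_of_forall_concl25`.  (Part 1 of 4: lines 1–276 of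 the transformed copy; the split is only for the 400-line rule.)

## References
* T. C. Hales, *A proof of Fejes Tóth's conjecture on sphere packings with kissing number twelve*,
  arXiv:1209.6043 (2012): Definition 1, Theorem 2 (main estimate `d₃`), Theorem 3, Lemmas 7–10. [`Hales2012`]
* R. E. Moore, *Interval Analysis* (1966), Theorem 3.1, §4.4. [`Moore1966`]
-/

noncomputable section

namespace Summit.Ventures.Crystal3D.Kissing125

open Literature.Geometry.DiscreteGeometry
open Real RealInnerProductSpace InnerProductGeometry Finset


/-! ## K25: the class `𝒱(5/2)` — twelve points of `S²(2)`, pairwise distances `2` or `≥ 5/2` -/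

section Predicate

open Real RealInnerProductSpace Finset


/-- **Hales's class `𝒱` with the separation `2h₀ = 2.52` replaced by `5/2`** (`h = 5/4`,
`κ = 1 − h²/2 = 7/32`): twelve points of the sphere of radius `2`, any two of which coincide,
touch (distance `2`) or are `≥ 5/2` apart.  Same shape as `IsKissingConfig` /
`IsGapKissingConfig (5/2)`. [cite: Hales2012, Definition 1] -/
def IsKissingConfig25 (S : Set (EuclideanSpace ℝ (Fin 3))) : Prop :=
  S.ncard = 12 ∧ (∀ x ∈ S, ‖x‖ = 2) ∧ ∀ x ∈ S, ∀ y ∈ S, x = y ∨ dist x y = 2 ∨ (5 / 2 : ℝ) ≤ dist x y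

variable {S : Set (EuclideanSpace ℝ (Fin 3))}

/-- Twelve points. [cite: Hales2012, Definition 1] -/
theorem IsKissingConfig25.ncard_eq (h : IsKissingConfig25 S) : S.ncard = 12 := h.1

/-- Finite. [folklore] -/
theorem IsKissingConfig25.finite (h : IsKissingConfig25 S) : S.Finite :=
  Set.finite_of_ncard_ne_zero (by rw [h.1]; norm_num)

/-- On `S²(2)`. [cite: Hales2012, Definition 1] -/
theorem IsKissingConfig25.norm_eq (h : IsKissingConfig25 S) {x : (EuclideanSpace ℝ (Fin 3))} (hx : x ∈ S) : ‖x‖ = 2 :=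
  h.2.1 x hx

/-- A packing: distinct points are `≥ 2` apart. [cite: Hales2012, Definition 1] -/
theorem IsKissingConfig25.two_le_dist (h : IsKissingConfig25 S) {x y : (EuclideanSpace ℝ (Fin 3))} (hx : x ∈ S) (hy : y ∈ S)
    (hxy : x ≠ y) : 2 ≤ dist x y := by
  rcases h.2.2 x hx y hy with h | h | h
  · exact absurd h hxy
  · exact h.ge
  · linarith

/-- The separation: distinct non-touching points are `≥ 5/2` apart. [cite: Hales2012, Definition 1] -/
theorem IsKissingConfig25.le_dist_of_ne (h : IsKissingConfig25 S) {x y : (EuclideanSpace ℝ (Fin 3))} (hx : x ∈ S) (hy : y ∈ S)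
    (hxy : x ≠ y) (h2 : dist x y ≠ 2) : (5 / 2 : ℝ) ≤ dist x y := by
  rcases h.2.2 x hx y hy with h | h | h
  · exact absurd h hxy
  · exact absurd h h2
  · exact h

/-- The unit configuration `V/2`. [cite: Hales2012, Definition 1] -/
def IsKissingConfig25.unitConfig (hS : IsKissingConfig25 S) : Finset (EuclideanSpace ℝ (Fin 3)) :=
  hS.finite.toFinset.image fun s => (1 / 2 : ℝ) • s

/-- Membership in `V/2`. [folklore] -/
theorem IsKissingConfig25.mem_unitConfig (hS : IsKissingConfig25 S) {y : (EuclideanSpace ℝ (Fin 3))} :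
    y ∈ hS.unitConfig ↔ ∃ s ∈ S, (1 / 2 : ℝ) • s = y := by
  unfold IsKissingConfig25.unitConfig
  simp only [Finset.mem_image, Set.Finite.mem_toFinset]

/-- `V/2` has twelve points. [cite: Hales2012, Definition 1] -/
theorem IsKissingConfig25.card_unitConfig (hS : IsKissingConfig25 S) : hS.unitConfig.card = 12 := by
  unfold IsKissingConfig25.unitConfig
  rw [Finset.card_image_of_injective _ (smul_right_injective (EuclideanSpace ℝ (Fin 3)) (by norm_num : (1 / 2 : ℝ) ≠ 0)),
    ← Set.ncard_coe_finset, Set.Finite.coe_toFinset, hS.ncard_eq]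

/-- `V/2` consists of unit vectors. [cite: Hales2012, Definition 1] -/
theorem IsKissingConfig25.norm_of_mem_unitConfig (hS : IsKissingConfig25 S) {y : (EuclideanSpace ℝ (Fin 3))}
    (hy : y ∈ hS.unitConfig) : ‖y‖ = 1 := by
  obtain ⟨s, hs, rfl⟩ := hS.mem_unitConfig.1 hy
  rw [norm_smul, hS.norm_eq hs]; norm_num

/-- **Separation on the unit sphere at `κ = 7/32`**: distinct points of `V/2` have inner product
`1/2` or `≤ 7/32`. [cite: Hales2012, Definition 1] -/
theorem IsKissingConfig25.inner_of_mem_unitConfig (hS : IsKissingConfig25 S) {y y' : (EuclideanSpace ℝ (Fin 3))}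
    (hy : y ∈ hS.unitConfig) (hy' : y' ∈ hS.unitConfig) (hne : y ≠ y') :
    ⟪y, y'⟫ = 1 / 2 ∨ ⟪y, y'⟫ ≤ 7 / 32 := by
  obtain ⟨s, hs, rfl⟩ := hS.mem_unitConfig.1 hy
  obtain ⟨t, ht, rfl⟩ := hS.mem_unitConfig.1 hy'
  have hst : s ≠ t := fun h => hne (by rw [h])
  have hd : dist s t ^ 2 = 8 - 2 * ⟪s, t⟫ := dist_sq_eq_of_norm_eq_two (hS.norm_eq hs) (hS.norm_eq ht)
  have hinner : ⟪(1 / 2 : ℝ) • s, (1 / 2 : ℝ) • t⟫ = ⟪s, t⟫ / 4 := by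
    rw [real_inner_smul_left, real_inner_smul_right]; ring
  rw [hinner]
  rcases hS.2.2 s hs t ht with h | h | h
  · exact absurd h hst
  · left
    rw [h] at hd
    linarith
  · right
    have h0 : (0 : ℝ) ≤ 5 / 2 := by norm_num
    have h2 : ((5 : ℝ) / 2) ^ 2 ≤ dist s t ^ 2 := pow_le_pow_left₀ h0 h 2
    rw [hd] at h2
    norm_num at h2 ⊢
    linarith

/-- Distinct points of `V/2` have inner product `≤ 1/2`. [cite: Hales2012, Definition 1] -/
theorem IsKissingConfig25.inner_le_half_of_mem_unitConfig (hS : IsKissingConfig25 S) :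
    ∀ y ∈ hS.unitConfig, ∀ y' ∈ hS.unitConfig, y ≠ y' → ⟪y, y'⟫ ≤ 1 / 2 := fun _ hy _ hy' hne =>
  (hS.inner_of_mem_unitConfig hy hy' hne).elim le_of_eq fun h => by linarith

/-- `0` is inside the hull of `V/2`. [cite: Hales2012, proof of Theorem 2] -/
theorem IsKissingConfig25.zero_mem_interior_unitConfig (hS : IsKissingConfig25 S) :
    (0 : (EuclideanSpace ℝ (Fin 3))) ∈ interior (convexHull ℝ (hS.unitConfig : Set (EuclideanSpace ℝ (Fin 3)))) :=
  zero_mem_interior_convexHull_of_twelve_unit hS.card_unitConfig (fun _ hy => hS.norm_of_mem_unitConfig hy)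
    hS.inner_le_half_of_mem_unitConfig

/-- **At least `23` contact pairs in `V/2`** (the K25 census). [cite: Hales2012, proof of Theorem 3 (weights)] -/
theorem IsKissingConfig25.twentythree_le (hS : IsKissingConfig25 S) :
    23 ≤ (contactPairsAt hS.unitConfig (1 / 2)).card :=
  twentythree_le_card_contactPairsAt hS.card_unitConfig (fun _ hy => hS.norm_of_mem_unitConfig hy)
    fun _ hy _ hy' hne => hS.inner_of_mem_unitConfig hy hy' hne

/-- `1 − (5/2)²/6 = −1/24 < 17/81`. [folklore] -/
theorem one_sub_sq_five_halves_div_six_lt : 1 - ((5 / 2 : ℝ)) ^ 2 / 6 < 17 / 81 := by norm_num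


/-- **No point of `S²(2)` has five neighbours** at distance exactly `2` whose pairwise distances
are all `2` or `≥ 5/2` (K25: Hales's `2h₀` replaced by `5/2`; numeric input `1 − (5/2)²/6 = −1/24 < 17/81`).  Proof: in an orthonormal frame with third vector `v/2` each neighbour is
`(X, Y, 1)` with `X² + Y² = 3`; with `θ = arg (X + iY)` one has `‖u − u'‖² = 6 − 6 cos (θ − θ')`,
so sorting the five angles contradicts `five_sorted_angles_false`.
[cite: Hales2012, Lemma 7 (proof)] -/
theorem no_five_neighbours25 {v : EuclideanSpace ℝ (Fin 3)} (hv : ‖v‖ = 2)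
    (u : Fin 5 → EuclideanSpace ℝ (Fin 3))
    (hinj : Function.Injective u) (hn : ∀ k, ‖u k‖ = 2) (hd : ∀ k, dist (u k) v = 2)
    (hsep : ∀ i j, i ≠ j → dist (u i) (u j) = 2 ∨ (5 / 2 : ℝ) ≤ dist (u i) (u j)) : False := by
  obtain ⟨b, hb⟩ := exists_orthonormalBasis_third_eq hv
  -- tangent coordinates
  set X : Fin 5 → ℝ := fun k => ⟪b 0, u k⟫ with hXdef
  set Y : Fin 5 → ℝ := fun k => ⟪b 1, u k⟫ with hYdef
  have hZ : ∀ k, ⟪b 2, u k⟫ = 1 := by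
    intro k
    rw [hb, real_inner_smul_left, real_inner_comm,
      inner_eq_two_of_dist_eq_two (hn k) hv (hd k)]
    norm_num
  have hXY : ∀ k, X k ^ 2 + Y k ^ 2 = 3 := by
    intro k
    have h4 : ⟪u k, u k⟫ = 4 := by
      rw [real_inner_self_eq_norm_sq, hn k]; norm_num
    rw [inner_eq_sum_three b, hZ k] at h4
    simp only [hXdef, hYdef]
    nlinarith [h4]
  set θ : Fin 5 → ℝ := fun k => Complex.arg ⟨X k, Y k⟩ with hθdef
  have hdist : ∀ i j, dist (u i) (u j) ^ 2 = 6 - 6 * cos (θ i - θ j) := by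
    intro i j
    have hc := mul_add_mul_eq_three_mul_cos (hXY i) (hXY j)
    rw [dist_eq_norm, norm_sub_sq_real, hn i, hn j, inner_eq_sum_three b, hZ i, hZ j]
    simp only [hθdef]
    linarith [hc]
  have hθinj : Function.Injective θ := by
    intro i j hij
    apply hinj
    obtain ⟨hXi, hYi⟩ := eq_sqrt_three_mul_cos_sin_arg (hXY i)
    obtain ⟨hXj, hYj⟩ := eq_sqrt_three_mul_cos_sin_arg (hXY j)
    have hij' : Complex.arg ⟨X i, Y i⟩ = Complex.arg ⟨X j, Y j⟩ := hij
    refine eq_of_inner_basis_eq b fun m => ?_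
    fin_cases m
    · show X i = X j
      rw [hXi, hXj, hij']
    · show Y i = Y j
      rw [hYi, hYj, hij']
    · simp only [Fin.reduceFinMk, hZ]
  -- the pairwise constraints in terms of angles
  have hC : ∀ i j, i ≠ j → cos (θ i - θ j) ≤ 1 / 3 ∧
      (cos (θ i - θ j) = 1 / 3 ∨ cos (θ i - θ j) ≤ 1 - ((5 / 2 : ℝ)) ^ 2 / 6) := by
    intro i j hij
    have hsq := hdist i j
    rcases hsep i j hij with h | h
    · rw [h] at hsq
      exact ⟨by linarith, Or.inl (by linarith)⟩
    · have h0 : (0 : ℝ) ≤ 5 / 2 := by norm_num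
      have h2 : ((5 / 2 : ℝ)) ^ 2 ≤ dist (u i) (u j) ^ 2 := pow_le_pow_left₀ h0 h 2
      have h252 : (2 : ℝ) ^ 2 ≤ ((5 / 2 : ℝ)) ^ 2 := by norm_num
      rw [hsq] at h2
      refine ⟨by linarith, Or.inr ?_⟩
      linarith
  -- sort the five angles
  have hAcard : (Finset.univ.image θ).card = 5 := by
    rw [Finset.card_image_of_injective _ hθinj, Finset.card_univ, Fintype.card_fin]
  let e := (Finset.univ.image θ).orderEmbOfFin hAcard
  have hmem : ∀ k, ∃ i, θ i = e k := by
    intro k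
    have := (Finset.univ.image θ).orderEmbOfFin_mem hAcard k
    rw [Finset.mem_image] at this
    obtain ⟨i, -, hi⟩ := this
    exact ⟨i, hi⟩
  choose π' hπ' using hmem
  refine five_sorted_angles_false one_sub_sq_five_halves_div_six_lt (fun k => e k) e.strictMono
    ?_ ?_ ?_
  · show -π < e 0
    rw [← hπ' 0]
    exact Complex.neg_pi_lt_arg _
  · show e 4 ≤ π
    rw [← hπ' 4]
    exact Complex.arg_le_pi _
  · intro i j hij
    have hne : π' i ≠ π' j := by
      intro h
      apply hij
      apply e.injective
      rw [← hπ' i, ← hπ' j, h]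
    rw [← hπ' i, ← hπ' j]
    exact hC _ _ hne

/-- **At most four neighbours (finite-set form).** If every point of the finite set `F ⊂ S²(2)`
is at distance `2` from `v ∈ S²(2)`, and any two distinct points of `F` are at distance `2` or
`≥ 5/2`, then `|F| ≤ 4`. [cite: Hales2012, Lemma 7] -/
theorem card_le_four_of_neighbours25 {v : EuclideanSpace ℝ (Fin 3)} (hv : ‖v‖ = 2)
    {F : Finset (EuclideanSpace ℝ (Fin 3))}
    (hn : ∀ u ∈ F, ‖u‖ = 2) (hd : ∀ u ∈ F, dist u v = 2)
    (hsep : ∀ u ∈ F, ∀ w ∈ F, u ≠ w → dist u w = 2 ∨ (5 / 2 : ℝ) ≤ dist u w) :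
    F.card ≤ 4 := by
  by_contra h
  obtain ⟨F', hF', hcard⟩ := Finset.exists_subset_card_eq (show 5 ≤ F.card by omega)
  set e := (Finset.equivFinOfCardEq hcard).symm with he
  refine no_five_neighbours25 hv (fun k => ((e k : F') : EuclideanSpace ℝ (Fin 3)))
    (Subtype.val_injective.comp e.injective) (fun k => hn _ (hF' (e k).2))
    (fun k => hd _ (hF' (e k).2)) fun i j hij => hsep _ (hF' (e i).2) _ (hF' (e j).2) ?_
  exact fun h => hij (e.injective (Subtype.val_injective h))

/-- **At most four contacts at each point of `V/2`** (Lemma 7 in the unit-sphere dictionary):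
for `y ∈ V/2`, `#{u ∈ V/2 | ⟪y, u⟫ = 1/2} ≤ 4`. [cite: Hales2012, Lemma 7] -/
theorem IsKissingConfig25.card_filter_inner_eq_half_le_four (hS : IsKissingConfig25 S) {y : (EuclideanSpace ℝ (Fin 3))}
    (hy : y ∈ hS.unitConfig) :
    (hS.unitConfig.filter fun u => ⟪y, u⟫ = 1 / 2).card ≤ 4 := by
  classical
  set C := hS.unitConfig.filter fun u => ⟪y, u⟫ = 1 / 2 with hC
  -- double everything: `F = 2 • C ⊆ S`, `v = 2 • y ∈ S`
  set F : Finset (EuclideanSpace ℝ (Fin 3)) := C.image fun u => (2 : ℝ) • u with hF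
  have hinj : Function.Injective fun u : (EuclideanSpace ℝ (Fin 3)) => (2 : ℝ) • u :=
    smul_right_injective (EuclideanSpace ℝ (Fin 3)) (by norm_num : (2 : ℝ) ≠ 0)
  have hcard : F.card = C.card := Finset.card_image_of_injective _ hinj
  rw [← hcard]
  have hy1 : ‖y‖ = 1 := hS.norm_of_mem_unitConfig hy
  have hv : ‖(2 : ℝ) • y‖ = 2 := by rw [norm_smul, hy1]; norm_num
  -- members of `C`: unit, in `V/2`, inner product `1/2` with `y`
  have hmemC : ∀ u ∈ C, u ∈ hS.unitConfig ∧ ⟪y, u⟫ = 1 / 2 := fun u hu => by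
    simpa [hC, Finset.mem_filter] using hu
  -- doubling a point of `V/2` gives a point of `S`
  have hmemS : ∀ u ∈ hS.unitConfig, (2 : ℝ) • u ∈ S := fun u hu => by
    obtain ⟨s, hs, rfl⟩ := hS.mem_unitConfig.1 hu
    rw [smul_smul]; norm_num; exact hs
  refine card_le_four_of_neighbours25 hv (F := F) ?_ ?_ ?_
  · -- norms
    intro w hw
    obtain ⟨u, hu, rfl⟩ := Finset.mem_image.1 hw
    exact hS.norm_eq (hmemS u (hmemC u hu).1)
  · -- distances to `2 • y`
    intro w hw
    obtain ⟨u, hu, rfl⟩ := Finset.mem_image.1 hw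
    obtain ⟨huX, hyu⟩ := hmemC u hu
    have hd := dist_eq_one_of_inner_eq_half hy1 (hS.norm_of_mem_unitConfig huX) hyu
    rw [dist_smul₀, hd]; norm_num
  · -- separation inside `S`
    intro w hw w' hw' hne
    obtain ⟨u, hu, rfl⟩ := Finset.mem_image.1 hw
    obtain ⟨u', hu', rfl⟩ := Finset.mem_image.1 hw'
    rcases hS.2.2 _ (hmemS u (hmemC u hu).1) _ (hmemS u' (hmemC u' hu').1) with h | h | h
    · exact absurd h hne
    · exact Or.inl h
    · exact Or.inr h

end Predicate

/-! ## K25 geometric dictionary (copy of KissingSearchGeometry, class `𝒱(5/2)`, structure `KConf` at κ = 7/32) -/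

namespace KissingSearch

open Real RealInnerProductSpace Finset

section Geometry


/-! ### Part A. The circumradius polynomial on a fan triangle -/

end Geometry
end KissingSearch
end Summit.Ventures.Crystal3D.Kissing125
end
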